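import Summits.KontsevichZagierPeriods.KontsevichZagierPeriods.Theorems.SymplecticScissorsPlanarAreasStubFibreDerivSemialgebraic
import Summits.KontsevichZagierPeriods.KontsevichZagierPeriods.Theorems.SymplecticScissorsPlanarAreasStubMixedPartials
import Summits.KontsevichZagierPeriods.KontsevichZagierPeriods.Theorems.SymplecticScissorsPlanarAreasStubDerivIntegrable
import Summits.KontsevichZagierPeriods.KontsevichZagierPeriods.Theorems.SymplecticScissorsPlanarAreasStubSwap
import Summits.KontsevichZagierPeriods.KontsevichZagierPeriods.Theorems.SymplecticScissorsPlanarCompilerStubSignedSweepAux3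
import Summits.KontsevichZagierPeriods.KontsevichZagierPeriods.Theorems.RealOnePeriodRelations.Negative.Kit
import Literature.NumberTheory.Transcendental.KZCalculusProofs
import Literature.NumberTheory.Transcendental.KZGroundingRelations
import Literature.NumberTheory.Transcendental.KZBetaChains

/-!
# `BetaLinearSector` (stmt-KontsevichZagierPeriods-3897), line `fermat-sector-transport`:
# Green's formula on the native triangle from the band Newton–Leibniz engine

Stub `stub_greenInRelations_of_bandNewtonLeibniz` of the lead skeleton: assuming the engine
(Newton–Leibniz down a band `{a₀ ≤ x ≤ a₁, α x ≤ y ≤ β x}` off a `ℚ`-semialgebraic null set),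
every instance `g = [∫₀¹ A(t,0)] + [∫₀¹ (B − A)(1−t,t)] − [∫₀¹ B(0,t)]` of the typed Green generator
`greenSet` (the 1-form `A da + B db` with a `C¹` potential on the open standard triangle, `A, B`
continuous and `ℚ`-semialgebraic on the closed triangle `Δ`) lies in `KZ.relations`.

Proof: the bulk representation `[Δ, ∂_b A]` exists (`PlanarAreas.stub_fibreDerivSemialgebraic`,
`PlanarAreas.stub_derivIntegrable`); the engine along `b` (exceptional null set from
`PlanarAreas.stub_mixedPartials`) gives `[Δ, ∂_b A] ≡ [∫₀¹ A(a,1−a) − A(a,0) da]`; after the swap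
move (`PlanarAreas.stub_swap`; `Δ` is swap-invariant and `∂_b A = ∂_a B` off the null set) the
engine gives `[Δ, ∂_b A] ≡ [∫₀¹ B(1−b,b) − B(0,b) db]`; the reflection `t ↦ 1 − t` (rule 2,
`KZ.of_sub_of_mem_relations_of_boxReflection`) and integrand additivity (rule 1b) finish.
[Kontsevich–Zagier 2001, §1.2]
-/

noncomputable section

namespace Summit.KontsevichZagierPeriods.FermatIsogeny.BetaLinearSector

open scoped BigOperators
open MeasureTheory Set
open Literature.NumberTheory.Transcendental
open Literature.ModelTheory.ExponentialFields (IsSemialgebraic)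
open Summit.KontsevichZagierPeriods.SymplecticScissors

/-! ## Geometry of the closed standard triangle as a band -/

/-- The closed standard triangle is the band `{0 ≤ a ≤ 1, 0 ≤ b ≤ 1 − a}`. [folklore] -/
theorem triangle_eq_band :
    {p : Fin 2 → ℝ | 0 ≤ p 0 ∧ 0 ≤ p 1 ∧ p 0 + p 1 ≤ 1} =
      {p : Fin 2 → ℝ | p 0 ∈ Set.Icc (0 : ℝ) 1 ∧ 0 ≤ p 1 ∧ p 1 ≤ 1 - p 0} := by
  ext p
  simp only [mem_setOf_eq, mem_Icc]
  constructor
  · rintro ⟨h0, h1, h2⟩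
    exact ⟨⟨h0, by linarith⟩, h1, by linarith⟩
  · rintro ⟨⟨h0, -⟩, h1, h2⟩
    exact ⟨h0, h1, by linarith⟩

/-- The swapped closed standard triangle is the same band (the triangle is symmetric). [folklore] -/
theorem swapTriangle_eq_band :
    {q : Fin 2 → ℝ | ![q 1, q 0] ∈ {p : Fin 2 → ℝ | 0 ≤ p 0 ∧ 0 ≤ p 1 ∧ p 0 + p 1 ≤ 1}} =
      {p : Fin 2 → ℝ | p 0 ∈ Set.Icc (0 : ℝ) 1 ∧ 0 ≤ p 1 ∧ p 1 ≤ 1 - p 0} := by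
  ext q
  simp only [mem_setOf_eq, mem_Icc, Matrix.cons_val_zero, Matrix.cons_val_one,
    Matrix.cons_val_fin_one]
  constructor
  · rintro ⟨h0, h1, h2⟩
    exact ⟨⟨h1, by linarith⟩, h0, by linarith⟩
  · rintro ⟨⟨h0, -⟩, h1, h2⟩
    exact ⟨h1, h0, by linarith⟩

/-- The lower edge function `α = 0` is `ℚ`-semialgebraic on `(0,1) ⊆ ℝ¹`. [folklore] -/
theorem isSemialgebraicFunOn_zero_unit :
    IsSemialgebraicFunOn ℚ {z : Fin 1 → ℝ | z 0 ∈ Set.Ioo (0 : ℝ) 1} (fun _ => (0 : ℝ)) :=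
  (isSemialgebraicFunOn_aeval RealOnePeriodRelationsNegative.isSemialgebraic_unitDom
    (0 : MvPolynomial (Fin 1) ℚ)).congr fun z _ => by simp

/-- The upper edge function `β t = 1 − t` is `ℚ`-semialgebraic on `(0,1) ⊆ ℝ¹`. [folklore] -/
theorem isSemialgebraicFunOn_one_sub_unit :
    IsSemialgebraicFunOn ℚ {z : Fin 1 → ℝ | z 0 ∈ Set.Ioo (0 : ℝ) 1} (fun z => 1 - z 0) :=
  (isSemialgebraicFunOn_aeval RealOnePeriodRelationsNegative.isSemialgebraic_unitDom
    (1 - MvPolynomial.X 0 : MvPolynomial (Fin 1) ℚ)).congr fun z _ => by simp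

/-- Continuity of `A` along the closed vertical fibres `{a} × [0, 1 − a]`, `a ∈ (0,1)`. [folklore] -/
theorem continuousOn_fibre_b {A : (Fin 2 → ℝ) → ℝ}
    (hAc : ContinuousOn A {p : Fin 2 → ℝ | 0 ≤ p 0 ∧ 0 ≤ p 1 ∧ p 0 + p 1 ≤ 1}) :
    ∀ t ∈ Set.Ioo (0 : ℝ) 1, ContinuousOn (fun s : ℝ => A ![t, s]) (Set.Icc 0 (1 - t)) := by
  intro t ht
  have hc : Continuous fun s : ℝ => (![t, s] : Fin 2 → ℝ) := by fun_prop
  refine hAc.comp hc.continuousOn fun s hs => ?_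
  simp only [mem_setOf_eq, Matrix.cons_val_zero, Matrix.cons_val_one, Matrix.cons_val_fin_one]
  exact ⟨ht.1.le, hs.1, by linarith [hs.2]⟩

/-- Continuity of `B ∘ swap` along the closed vertical fibres, i.e. of `B` along the closed
horizontal fibres `[0, 1 − b] × {b}`, `b ∈ (0,1)`. [folklore] -/
theorem continuousOn_fibre_a {B : (Fin 2 → ℝ) → ℝ}
    (hBc : ContinuousOn B {p : Fin 2 → ℝ | 0 ≤ p 0 ∧ 0 ≤ p 1 ∧ p 0 + p 1 ≤ 1}) :
    ∀ t ∈ Set.Ioo (0 : ℝ) 1, ContinuousOn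
      (fun s : ℝ => (fun q : Fin 2 → ℝ => B ![q 1, q 0]) ![t, s]) (Set.Icc 0 (1 - t)) := by
  intro t ht
  simp only [Matrix.cons_val_one, Matrix.cons_val_fin_one, Matrix.cons_val_zero]
  have hc : Continuous fun s : ℝ => (![s, t] : Fin 2 → ℝ) := by fun_prop
  refine hBc.comp hc.continuousOn fun s hs => ?_
  simp only [mem_setOf_eq, Matrix.cons_val_zero, Matrix.cons_val_one, Matrix.cons_val_fin_one]
  exact ⟨hs.1, ht.1.le, by linarith [hs.2]⟩

/-- The swap of a `ℚ`-semialgebraic null set is null (the swap preserves Lebesgue measure).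
[folklore] -/
theorem volume_swap_eq_zero {Z : Set (Fin 2 → ℝ)} (hZ : IsSemialgebraic ℚ Z)
    (hZ0 : volume Z = 0) : volume {q : Fin 2 → ℝ | ![q 1, q 0] ∈ Z} = 0 := by
  have hZm : MeasurableSet Z :=
    Literature.ModelTheory.ExponentialFields.IsSemialgebraic.measurableSet_holds hZ
  have key : {q : Fin 2 → ℝ | ![q 1, q 0] ∈ Z} =
      (fun q : Fin 2 → ℝ => q ∘ ⇑(Equiv.swap (0 : Fin 2) 1)) ⁻¹' Z := by
    ext q
    simp only [mem_setOf_eq, mem_preimage, PlanarAreas.comp_swap_eq]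
  rw [key, (Grounding.measurePreserving_comp_perm (m := 1)
    (Equiv.swap (0 : Fin 2) 1)).measure_preimage hZm.nullMeasurableSet, hZ0]

/-! ## The derivative clauses of the two engine runs -/

/-- Along `b`: off `Z`, on the open triangle, `∂_b A` is the bulk integrand. [folklore] -/
theorem hasDerivAt_bulk_b {A : (Fin 2 → ℝ) → ℝ} {Z : Set (Fin 2 → ℝ)}
    (hZ : ∀ p : Fin 2 → ℝ, 0 < p 0 → 0 < p 1 → p 0 + p 1 < 1 → p ∉ Z →
      HasDerivAt (fun s : ℝ => A ![p 0, s]) (deriv (fun s : ℝ => A ![p 0, s]) (p 1)) (p 1))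
    (r : KZ.IntegralRep 2)
    (hr : r.integrand = fun p => if 0 < p 0 ∧ 0 < p 1 ∧ p 0 + p 1 < 1
      then deriv (fun s : ℝ => A ![p 0, s]) (p 1) else 0) :
    ∀ p ∈ r.domain, p 0 ∈ Set.Ioo (0 : ℝ) 1 → 0 < p 1 → p 1 < 1 - p 0 → p ∉ Z →
      HasDerivAt (fun s : ℝ => A ![p 0, s]) (r.integrand p) (p 1) := by
  intro p _ h0 h1 h2 hpZ
  have h2' : p 0 + p 1 < 1 := by linarith
  have hint : r.integrand p = deriv (fun s : ℝ => A ![p 0, s]) (p 1) := by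
    rw [hr]
    exact if_pos ⟨h0.1, h1, h2'⟩
  rw [hint]
  exact hZ p h0.1 h1 h2' hpZ

/-- Along `a` (after the swap): off `swap⁻¹ Z`, on the open triangle, the swapped bulk integrand
`(∂_b A) ∘ swap` is the fibre derivative of `B ∘ swap` (`∂_b A = ∂_a B` off `Z`). [folklore] -/
theorem hasDerivAt_bulk_a {A B : (Fin 2 → ℝ) → ℝ} {Z : Set (Fin 2 → ℝ)}
    (hZ : ∀ p : Fin 2 → ℝ, 0 < p 0 → 0 < p 1 → p 0 + p 1 < 1 → p ∉ Z →
      HasDerivAt (fun s : ℝ => B ![s, p 1]) (deriv (fun s : ℝ => A ![p 0, s]) (p 1)) (p 0))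
    (r : KZ.IntegralRep 2)
    (hr : r.integrand = fun p => if 0 < p 0 ∧ 0 < p 1 ∧ p 0 + p 1 < 1
      then deriv (fun s : ℝ => A ![p 0, s]) (p 1) else 0)
    (r' : KZ.IntegralRep 2) (hr' : ∀ q ∈ r'.domain, r'.integrand q = r.integrand ![q 1, q 0]) :
    ∀ q ∈ r'.domain, q 0 ∈ Set.Ioo (0 : ℝ) 1 → 0 < q 1 → q 1 < 1 - q 0 →
      q ∉ {q : Fin 2 → ℝ | ![q 1, q 0] ∈ Z} →
      HasDerivAt (fun s : ℝ => (fun q : Fin 2 → ℝ => B ![q 1, q 0]) ![q 0, s])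
        (r'.integrand q) (q 1) := by
  intro q hq h0 h1 h2 hqZ
  have h2' : q 1 + q 0 < 1 := by linarith
  have hint : r'.integrand q = deriv (fun s : ℝ => A ![q 1, s]) (q 0) := by
    rw [hr' q hq, hr]
    simp only [Matrix.cons_val_zero, Matrix.cons_val_one, Matrix.cons_val_fin_one]
    exact if_pos ⟨h1, h0.1, h2'⟩
  rw [hint]
  simp only [Matrix.cons_val_one, Matrix.cons_val_fin_one, Matrix.cons_val_zero]
  have key := hZ ![q 1, q 0]
  simp only [Matrix.cons_val_zero, Matrix.cons_val_one, Matrix.cons_val_fin_one] at key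
  exact key h1 h0.1 h2' hqZ

/-! ## Edge representations on `(0,1)` and the reflection `t ↦ 1 − t` -/

/-- **Edge representations exist**: for `f` continuous and `ℚ`-semialgebraic on the closed
triangle and a continuous edge parametrisation `φ : [0,1] → Δ` which is a `ℚ`-semialgebraic map on
`(0,1)`, the representation `[∫_{(0,1)} f (φ t) dt]` exists (semialgebraic by composition,
absolutely integrable since `f ∘ φ` is continuous on `[0,1]`). [cite: KontsevichZagier2001, §1.1] -/
theorem exists_edgeRep {f : (Fin 2 → ℝ) → ℝ}
    (hf : IsSemialgebraicFunOn ℚ {p : Fin 2 → ℝ | 0 ≤ p 0 ∧ 0 ≤ p 1 ∧ p 0 + p 1 ≤ 1} f)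
    (hfc : ContinuousOn f {p : Fin 2 → ℝ | 0 ≤ p 0 ∧ 0 ≤ p 1 ∧ p 0 + p 1 ≤ 1})
    (φ : ℝ → (Fin 2 → ℝ))
    (hφ : IsSemialgebraicMapOn ℚ {z : Fin 1 → ℝ | z 0 ∈ Set.Ioo (0 : ℝ) 1} (fun z => φ (z 0)))
    (hφc : Continuous φ)
    (hφΔ : ∀ t ∈ Set.Icc (0 : ℝ) 1, φ t ∈ {p : Fin 2 → ℝ | 0 ≤ p 0 ∧ 0 ≤ p 1 ∧ p 0 + p 1 ≤ 1}) :
    ∃ ρ : KZ.IntegralRep 1, ρ.domain = {z : Fin 1 → ℝ | z 0 ∈ Set.Ioo (0 : ℝ) 1} ∧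
      ∀ z, ρ.integrand z = f (φ (z 0)) := by
  have hcont : ContinuousOn (fun t => f (φ t)) (Set.Icc (0 : ℝ) 1) :=
    hfc.comp hφc.continuousOn hφΔ
  have hint : IntegrableOn (fun t => f (φ t)) (Set.Ioo (0 : ℝ) 1) :=
    hcont.integrableOn_Icc.mono_set Ioo_subset_Icc_self
  exact ⟨{ domain := {z : Fin 1 → ℝ | z 0 ∈ Set.Ioo (0 : ℝ) 1}
           integrand := fun z => f (φ (z 0))
           isSemialgebraic_domain := RealOnePeriodRelationsNegative.isSemialgebraic_unitDom
           isSemialgebraicFunOn_integrand :=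
             IsSemialgebraicFunOn.comp_isSemialgebraicMapOn_holds hf hφ
               fun z hz => hφΔ _ (Ioo_subset_Icc_self hz)
           integrableOn := (KZ.integrableOn_setOf_apply_mem_iff (g := fun t => f (φ t))).2 hint },
    rfl, fun _ => rfl⟩

/-- The hypotenuse representation `[∫_{(0,1)} f (1 − t, t) dt]` exists. [cite: KontsevichZagier2001, §1.1] -/
theorem exists_edgeRep_hyp {f : (Fin 2 → ℝ) → ℝ}
    (hf : IsSemialgebraicFunOn ℚ {p : Fin 2 → ℝ | 0 ≤ p 0 ∧ 0 ≤ p 1 ∧ p 0 + p 1 ≤ 1} f)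
    (hfc : ContinuousOn f {p : Fin 2 → ℝ | 0 ≤ p 0 ∧ 0 ≤ p 1 ∧ p 0 + p 1 ≤ 1}) :
    ∃ ρ : KZ.IntegralRep 1, ρ.domain = {z : Fin 1 → ℝ | z 0 ∈ Set.Ioo (0 : ℝ) 1} ∧
      ∀ z, ρ.integrand z = f ![1 - z 0, z 0] := by
  refine exists_edgeRep hf hfc (fun t => ![1 - t, t]) ?_ (by fun_prop) fun t ht => ?_
  · refine (isSemialgebraicMapOn_aeval RealOnePeriodRelationsNegative.isSemialgebraic_unitDom
      ![1 - MvPolynomial.X 0, MvPolynomial.X 0]).congr fun z _ => ?_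
    funext j
    fin_cases j <;> simp
  · simp only [mem_setOf_eq, Matrix.cons_val_zero, Matrix.cons_val_one, Matrix.cons_val_fin_one]
    exact ⟨by linarith [ht.2], ht.1, by linarith⟩

/-- The reflected hypotenuse representation `[∫_{(0,1)} f (t, 1 − t) dt]` exists.
[cite: KontsevichZagier2001, §1.1] -/
theorem exists_edgeRep_hyp' {f : (Fin 2 → ℝ) → ℝ}
    (hf : IsSemialgebraicFunOn ℚ {p : Fin 2 → ℝ | 0 ≤ p 0 ∧ 0 ≤ p 1 ∧ p 0 + p 1 ≤ 1} f)
    (hfc : ContinuousOn f {p : Fin 2 → ℝ | 0 ≤ p 0 ∧ 0 ≤ p 1 ∧ p 0 + p 1 ≤ 1}) :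
    ∃ ρ : KZ.IntegralRep 1, ρ.domain = {z : Fin 1 → ℝ | z 0 ∈ Set.Ioo (0 : ℝ) 1} ∧
      ∀ z, ρ.integrand z = f ![z 0, 1 - z 0] := by
  refine exists_edgeRep hf hfc (fun t => ![t, 1 - t]) ?_ (by fun_prop) fun t ht => ?_
  · refine (isSemialgebraicMapOn_aeval RealOnePeriodRelationsNegative.isSemialgebraic_unitDom
      ![MvPolynomial.X 0, 1 - MvPolynomial.X 0]).congr fun z _ => ?_
    funext j
    fin_cases j <;> simp
  · simp only [mem_setOf_eq, Matrix.cons_val_zero, Matrix.cons_val_one, Matrix.cons_val_fin_one]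
    exact ⟨ht.1, by linarith [ht.2], by linarith⟩

/-- **The reflection `t ↦ 1 − t` is a move** (rule 2, `|det| = 1`):
`[∫_{(0,1)} f (t, 1 − t) dt] ≡ [∫_{(0,1)} f (1 − t, t) dt]`. [cite: KontsevichZagier2001, §1.2 rule (2)] -/
theorem of_sub_of_mem_relations_reflect {f : (Fin 2 → ℝ) → ℝ} (ρ ρ' : KZ.IntegralRep 1)
    (hρd : ρ.domain = {z : Fin 1 → ℝ | z 0 ∈ Set.Ioo (0 : ℝ) 1})
    (hρ'd : ρ'.domain = {z : Fin 1 → ℝ | z 0 ∈ Set.Ioo (0 : ℝ) 1})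
    (hρi : ∀ z, ρ.integrand z = f ![z 0, 1 - z 0]) (hρ'i : ∀ z, ρ'.integrand z = f ![1 - z 0, z 0]) :
    KZ.of ρ - KZ.of ρ' ∈ KZ.relations := by
  refine KZ.of_sub_of_mem_relations_of_boxReflection (0 : Fin 1) ?_ fun x _ => ?_
  · rw [hρd, hρ'd]
    ext x
    simp only [mem_setOf_eq, mem_preimage, KZ.boxReflection_apply_self, mem_Ioo]
    constructor <;> rintro ⟨h1, h2⟩ <;> constructor <;> linarith
  · rw [hρi, hρ'i]
    simp only [KZ.boxReflection_apply_self, sub_sub_cancel]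

/-! ## The stub -/

/-- GREEN STUB 4 (Green's formula on the native triangle from the engine): if Newton–Leibniz down a band off a null set is
available (GREEN STUB 3's conclusion), every instance `[∫A(t,0)] + [∫(B−A)(1−t,t)] − [∫B(0,t)]` of the typed Green generator of
stmt-10042 (`A da + B db` with a `C¹` potential on the open triangle, `A, B` continuous and `ℚ`-semialgebraic on the closed one)
lies in `KZ.relations`: the bulk `[Δ, ∂_b A]` exists (`PlanarAreas.stub_fibreDerivSemialgebraic`, `stub_derivIntegrable`), equals
`[∫₀¹ A(a,1−a) − A(a,0) da]` by the engine along `b` (exceptional set from `PlanarAreas.stub_mixedPartials`), and — after the swap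
move `PlanarAreas.stub_swap`, `Δ` being swap-invariant and `∂_b A = ∂_a B` a.e. — also `[∫₀¹ B(1−b,b) − B(0,b) db]`; the reflection
`t ↦ 1 − t` (rule 2) and rule 1b finish. [cite: KontsevichZagier2001, §1.2 rules (1)–(3)] -/
theorem stub_greenInRelations_of_bandNewtonLeibniz :
    (∀ (a₀ a₁ : ℚ) (α β : ℝ → ℝ) (F : (Fin 2 → ℝ) → ℝ) (Z : Set (Fin 2 → ℝ)) (r : KZ.IntegralRep 2), a₀ < a₁ →
      IsSemialgebraicFunOn ℚ {z : Fin 1 → ℝ | z 0 ∈ Set.Ioo (a₀ : ℝ) a₁} (fun z => α (z 0)) →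
      IsSemialgebraicFunOn ℚ {z : Fin 1 → ℝ | z 0 ∈ Set.Ioo (a₀ : ℝ) a₁} (fun z => β (z 0)) →
      (∀ t ∈ Set.Ioo (a₀ : ℝ) a₁, α t ≤ β t) →
      r.domain = {p : Fin 2 → ℝ | p 0 ∈ Set.Icc (a₀ : ℝ) a₁ ∧ α (p 0) ≤ p 1 ∧ p 1 ≤ β (p 0)} →
      IsSemialgebraicFunOn ℚ r.domain F → (∃ M : ℝ, ∀ p ∈ r.domain, |F p| ≤ M) →
      (∀ t ∈ Set.Ioo (a₀ : ℝ) a₁, ContinuousOn (fun s : ℝ => F ![t, s]) (Set.Icc (α t) (β t))) →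
      IsSemialgebraic ℚ Z → volume Z = 0 →
      (∀ p ∈ r.domain, p 0 ∈ Set.Ioo (a₀ : ℝ) a₁ → α (p 0) < p 1 → p 1 < β (p 0) → p ∉ Z →
        HasDerivAt (fun s : ℝ => F ![p 0, s]) (r.integrand p) (p 1)) →
      ∃ r' : KZ.IntegralRep 1, r'.domain = {z : Fin 1 → ℝ | z 0 ∈ Set.Ioo (a₀ : ℝ) a₁} ∧
        (∀ z ∈ r'.domain, r'.integrand z = F ![z 0, β (z 0)] - F ![z 0, α (z 0)]) ∧
        KZ.of r - KZ.of r' ∈ KZ.relations) →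
    ∀ g ∈ Summit.KontsevichZagierPeriods.SymplecticScissors.RealOnePeriodRelationsNegative.greenSet,
      g ∈ Literature.NumberTheory.Transcendental.KZ.relations := by
  intro hE g hg
  obtain ⟨Δ, A, B, S, r₀₁, r₁₂, r₀₂, hΔ, hA, hB, hAc, hBc, hS, hd₀₁, hd₁₂, hd₀₂, hi₀₁, hi₁₂, hi₀₂,
    rfl⟩ := hg
  subst hΔ
  -- the engine on the band `{0 ≤ a ≤ 1, 0 ≤ b ≤ 1 - a}`
  have hE1 := hE 0 1 (fun _ => (0 : ℝ)) (fun t => 1 - t)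
  simp only [Rat.cast_zero, Rat.cast_one] at hE1
  have hαβ : ∀ t ∈ Set.Ioo (0 : ℝ) 1, (0 : ℝ) ≤ 1 - t := fun t ht => by linarith [ht.2]
  -- (i) the bulk representation `[Δ, ∂_b A]`
  obtain ⟨Z, hZsa, hZ0, hZ⟩ := PlanarAreas.stub_mixedPartials A B S hA hB hS
  have hhsa := PlanarAreas.stub_fibreDerivSemialgebraic A hA
  have hhint := PlanarAreas.stub_derivIntegrable A hA hAc hhsa
  have hΔsa : IsSemialgebraic ℚ {p : Fin 2 → ℝ | 0 ≤ p 0 ∧ 0 ≤ p 1 ∧ p 0 + p 1 ≤ 1} :=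
    IsSemialgebraicFunOn.isSemialgebraic_holds hA
  obtain ⟨rΔ, hrΔd, hrΔi⟩ : ∃ rΔ : KZ.IntegralRep 2,
      rΔ.domain = {p : Fin 2 → ℝ | 0 ≤ p 0 ∧ 0 ≤ p 1 ∧ p 0 + p 1 ≤ 1} ∧
      rΔ.integrand = fun p => if 0 < p 0 ∧ 0 < p 1 ∧ p 0 + p 1 < 1
        then deriv (fun s : ℝ => A ![p 0, s]) (p 1) else 0 :=
    ⟨⟨_, _, hΔsa, hhsa, hhint⟩, rfl, rfl⟩
  -- (ii) the engine along `b`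
  obtain ⟨M, hM⟩ := PlanarCompilerProof.exists_bound_closedTriangle hAc
  obtain ⟨r₁, hr₁d, hr₁i, e₁⟩ := hE1 A Z rΔ one_pos isSemialgebraicFunOn_zero_unit
    isSemialgebraicFunOn_one_sub_unit hαβ (hrΔd.trans triangle_eq_band) (by rw [hrΔd]; exact hA)
    (by rw [hrΔd]; exact ⟨M, hM⟩) (continuousOn_fibre_b hAc) hZsa hZ0
    (hasDerivAt_bulk_b (fun p h0 h1 h2 hpZ => (hZ p h0 h1 h2 hpZ).1) rΔ hrΔi)
  -- (iii) the swap move and the engine along `a`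
  obtain ⟨rΔs, hsd, hsi, eS⟩ := PlanarAreas.stub_swap rΔ
  rw [hrΔd] at hsd
  obtain ⟨M', hM'⟩ := PlanarCompilerProof.exists_bound_closedTriangle hBc
  obtain ⟨r₂, hr₂d, hr₂i, e₂⟩ := hE1 (fun q : Fin 2 → ℝ => B ![q 1, q 0])
    {q : Fin 2 → ℝ | ![q 1, q 0] ∈ Z} rΔs one_pos isSemialgebraicFunOn_zero_unit
    isSemialgebraicFunOn_one_sub_unit hαβ (hsd.trans swapTriangle_eq_band)
    (by rw [hsd]; exact PlanarAreas.isSemialgebraicFunOn_swap hΔsa hB)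
    (by rw [hsd]; exact ⟨M', fun q hq => hM' _ hq⟩) (continuousOn_fibre_a hBc)
    (PlanarAreas.isSemialgebraic_swap hZsa) (volume_swap_eq_zero hZsa hZ0)
    (hasDerivAt_bulk_a (fun p h0 h1 h2 hpZ => (hZ p h0 h1 h2 hpZ).2) rΔ hrΔi rΔs hsi)
  have hr₂i' : ∀ z ∈ r₂.domain, r₂.integrand z = B ![1 - z 0, z 0] - B ![0, z 0] := by
    intro z hz
    rw [hr₂i z hz]
    simp only [Matrix.cons_val_one, Matrix.cons_val_fin_one, Matrix.cons_val_zero]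
  -- (iv) the edges, the reflection, and the assembly by rule 1b
  obtain ⟨rA, hrAd, hrAi⟩ := exists_edgeRep_hyp hA hAc
  obtain ⟨rAr, hrArd, hrAri⟩ := exists_edgeRep_hyp' hA hAc
  obtain ⟨rB, hrBd, hrBi⟩ := exists_edgeRep_hyp hB hBc
  have eR : KZ.of rAr - KZ.of rA ∈ KZ.relations :=
    of_sub_of_mem_relations_reflect rAr rA hrArd hrAd hrAri hrAi
  have e₃ : KZ.of rAr - KZ.of r₁ - KZ.of r₀₁ ∈ KZ.relations := by
    refine KZ.integrandAddRel_subset_relations ⟨1, rAr, r₁, r₀₁, hr₁d.trans hrArd.symm,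
      hd₀₁.trans hrArd.symm, fun z hz => ?_, rfl⟩
    rw [hrArd] at hz
    rw [Pi.add_apply, hrAri z, hr₁i z (by rw [hr₁d]; exact hz), hi₀₁ z (by rw [hd₀₁]; exact hz)]
    ring
  have e₄ : KZ.of rB - KZ.of r₂ - KZ.of r₀₂ ∈ KZ.relations := by
    refine KZ.integrandAddRel_subset_relations ⟨1, rB, r₂, r₀₂, hr₂d.trans hrBd.symm,
      hd₀₂.trans hrBd.symm, fun z hz => ?_, rfl⟩
    rw [hrBd] at hz
    rw [Pi.add_apply, hrBi z, hr₂i' z (by rw [hr₂d]; exact hz), hi₀₂ z (by rw [hd₀₂]; exact hz)]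
    ring
  have e₅ : KZ.of rB - KZ.of r₁₂ - KZ.of rA ∈ KZ.relations := by
    refine KZ.integrandAddRel_subset_relations ⟨1, rB, r₁₂, rA, hd₁₂.trans hrBd.symm,
      hrAd.trans hrBd.symm, fun z hz => ?_, rfl⟩
    rw [hrBd] at hz
    rw [Pi.add_apply, hrBi z, hi₁₂ z (by rw [hd₁₂]; exact hz), hrAi z]
    ring
  have key : KZ.of r₀₁ + KZ.of r₁₂ - KZ.of r₀₂ =
      (KZ.of rΔ - KZ.of r₁) - (KZ.of rΔ - KZ.of rΔs) - (KZ.of rΔs - KZ.of r₂) +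
        (KZ.of rAr - KZ.of rA) - (KZ.of rAr - KZ.of r₁ - KZ.of r₀₁) +
        (KZ.of rB - KZ.of r₂ - KZ.of r₀₂) - (KZ.of rB - KZ.of r₁₂ - KZ.of rA) := by
    abel
  rw [key]
  exact KZ.relations.sub_mem (KZ.relations.add_mem (KZ.relations.sub_mem (KZ.relations.add_mem
    (KZ.relations.sub_mem (KZ.relations.sub_mem e₁ eS) e₂) eR) e₃) e₄) e₅

end Summit.KontsevichZagierPeriods.FermatIsogeny.BetaLinearSector

end
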